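import Literature.NumberTheory.Transcendental.KZCalculusOver
import Literature.NumberTheory.Transcendental.KZMoveFamily
import HarnessLib

/-!
# Raw semialgebraic families of move instances of the Kontsevich–Zagier calculus (tame move families)

Definition request `defn-TameMoveFamily` (route KontsevichZagierPeriods/InequalityCost, items
TameSqueeze and its foreseen split UniformFromBounded / UniformClosure; shared with route
StandardParts' SpUniformClosure). Companion to `KZCalculus.lean`, `KZCalculusOver.lean` and
`KZMoveFamily.lean`.

A *family* of subsets of `ℝⁿ` over the parameter line is, as in van den Dries [Dries1998, Ch. 3,
(3.1)], the family of fibres of ONE total set `S ⊆ ℝⁿ⁺¹`; here the parameter is the **last**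
coordinate, the fibre at `t` is `S_t = {x | Fin.snoc x t ∈ S}` and a total integrand `G` on `S`
restricts to `G_t x = G (Fin.snoc x t)` — verbatim the convention of the route items TameCovLimit,
TameNLLimit, AddLimits, TameLimitExists, and of `KZ.totalSet` / `KZ.IsSemialgebraicSetFamilyOn`
in `KZMoveFamily.lean`. The total data are `ℚ`-semialgebraic (`RawFamily`); the fibres are PLAIN
sets and functions (`ℚ`-semialgebraic only at algebraic parameters, `RawFamily.isSemialgebraic_fibre`
for `t ∈ ℚ`), **not** `KZ.IntegralRep`s — this is the difference with `KZ.MoveFamilyOn` of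
`KZMoveFamily.lean`, whose fibres are honest move instances between `KZ.IntegralRep`s and which is
therefore (as recorded in that file's design notes) locally constant near transcendental
parameters; route InequalityCost needs non-trivial `t`-dependence on whole intervals `(0, δ)`, only
the LIMITS at `0⁺` being representations.

For each of the four moves of the calculus (`KZ.domainAddRel`, `KZ.integrandAddRel`,
`KZ.changeOfVariablesRel`, `KZ.newtonLeibnizRel`, [KZ 2001, §1.2]) a *raw move family over
`T ⊆ ℝ`* (`RawDomainAddFamilyOn T n`, `RawIntegrandAddFamilyOn T n`, `RawCovFamilyOn T n`,
`RawNLFamilyOn T n`; together `RawMoveFamilyOn T`) consists of raw families for the pairs entering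
the move and `ℚ`-semialgebraic total auxiliary data (the change of variables `Φ`, the band functions
`a ≤ b`, the primitive `F`) such that **for every `t ∈ T` the fibre data satisfy the side conditions
of the move**, written exactly as in `KZCalculus` (and as inlined in the route items; integrability
and `ℚ`-semialgebraicity of the fibres, which make no sense for raw real fibres, being the only
clauses dropped). Its value at `t` is the formal combination `gen t` of the (indicator-normalised)
fibre raw pairs in the free abelian group `RawGroup` on all raw pairs `(σ ⊆ ℝᵏ, f)` — the group of
route InequalityCost's BoundedCost, with the generator `KZOver.Raw.gen` of `KZCalculusOver`.
`UniformChainOn T c` says that a family `c : ℝ → RawGroup` of formal combinations is, for all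
`t ∈ T` at once, a fixed `ℤ`-combination of the values of finitely many raw move families ("one
template of moves whose data vary semialgebraically with `t`", the raw analogue of
`KZ.UniformlyEquivalentOn`); `IsTame N` bounds dimensions, domains (`⊆ [−N, N]ᵏ`), integrands and
primitives by `N`; `TameMoveFamily N T` is the type of `N`-tame raw move families and
`TameUniformChainOn N T c` the tame, signed, `≤ N`-term version of `UniformChainOn`.

## Main definitions (namespace `Literature.NumberTheory.Transcendental.KZ`)

* `RawGroup` — the free abelian group on raw pairs `Σ k, Set (Fin k → ℝ) × ((Fin k → ℝ) → ℝ)`.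
* `RawFamily n`, `RawFamily.fibre`, `.fibreFun`, `.gen`, `.IsTame`, `.HasL1Limit`, `.const`,
  `.rescale`.
* `RawDomainAddFamilyOn`, `RawIntegrandAddFamilyOn`, `RawCovFamilyOn`, `RawNLFamilyOn`,
  `RawMoveFamilyOn` (with `gen`, `IsTame`, `restrict`), `TameMoveFamily N T`.
* `UniformChainOn T c`, `TameUniformChainOn N T c`.

## Main statements (all proved)

* `IsSemialgebraicFunOn.comp_aeval`, `IsSemialgebraicMapOn.comp_aeval` — pull-back of
  semialgebraic functions / maps along polynomial maps (no Tarski–Seidenberg), whence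
  `RawFamily.isSemialgebraic_fibre`, `RawFamily.isSemialgebraicFunOn_fibreFun` (fibres at rational
  parameters are `ℚ`-semialgebraic) and the rescaling `RawFamily.rescale` by a rational factor
  (`RawFamily.HasL1Limit.rescale`).
* bridge to `KZMoveFamily.lean`: `RawFamily.isSemialgebraicSetFamilyOn`,
  `RawFamily.isSemialgebraicFunFamilyOn`, `RawCovFamilyOn.isSemialgebraicMapFamilyOn` — the fibres
  of a raw family form semialgebraic families in the (ambient) sense of that file, over any `T`.
* fibre extraction: `RawDomainAddFamilyOn.mem_domainAddRel`,
  `RawIntegrandAddFamilyOn.mem_integrandAddRel`, `RawCovFamilyOn.mem_changeOfVariablesRel`,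
  `RawNLFamilyOn.mem_newtonLeibnizRel` — if integral representations realise the fibre data at
  `t ∈ T` (for moves (2), (3): and the fibre auxiliary maps are `ℚ`-semialgebraic, automatic for
  `t ∈ ℚ`), their formal combination IS an instance of the corresponding KZ move.
* `RawFamily.hasL1Limit_const` (constant families converge to themselves),
  `UniformChainOn.mono`, `TameUniformChainOn.uniformChainOn`, `TameUniformChainOn.mono`,
  `tameUniformChainOn_zero`; rescaling of the parameter: `RawMoveFamilyOn.gen_rescale`,
  `UniformChainOn.rescale`.

## References

* M. Kontsevich, D. Zagier, *Periods*, in: Mathematics Unlimited — 2001 and Beyond, Springer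
  (2001), §1.2 (the three rules).
* L. van den Dries, *Tame topology and o-minimal structures*, LMS LNS 248, CUP (1998), Ch. 3
  (3.1) (definable families as fibres of a definable total set), Ch. 6 (1.2) (definable choice),
  Ch. 9 (trivialization).
* J. Bochnak, M. Coste, M.-F. Roy, *Real Algebraic Geometry* (1998), §2.2.

## Design notes

* Why raw fibres and not `ℝ → KZ.IntegralRep n`: a `KZ.IntegralRep` has a `ℚ`-semialgebraic
  domain, but the real fibres `S_t` of a `ℚ`-semialgebraic `S` are `ℚ`-semialgebraic only for
  algebraic `t` in general (e.g. `S = {0 ≤ x ≤ t}`), so an `IntegralRep`-valued semialgebraic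
  family is locally constant off algebraic parameters (`KZMoveFamily.lean`, design notes); the
  route therefore asks for total objects whose fibres are mere sets/functions, only LIMITS being
  representations (`RawFamily.HasL1Limit`, the clause of item TameLimitExists verbatim:
  `RawFamily.hasL1Limit_iff` is `Iff.rfl`).
* The generator `RawFamily.gen S t = [(S_t, 𝟙_{S_t} · G_t)]` extends the fibre integrand by zero
  off the fibre, as BoundedCost's admissible pairs do ("zero off the domain"), so that generator
  coincidences in `RawGroup` depend only on `(S_t, G_t|S_t)`; the side conditions are stated for
  the un-normalised `fibreFun` and only ever evaluate it on the fibre.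
* Side conditions are copied from the route items with `T` for `Set.Ioo 0 1`: membership
  `x ∈ S.fibre t` unfolds definitionally to `Fin.snoc x t ∈ S.total`, so the fields of a family
  over `Set.Ioo 0 1` are, clause by clause and up to definitional unfolding, the side-condition
  hypotheses of TameCovLimit / TameNLLimit / AddLimits (first half; the second half of AddLimits
  asks `G = G₁ + G₂` on the total space, which is the fibrewise identity once the total domain lies
  over `T`).
  In `RawIntegrandAddFamilyOn` the three total domains coincide (as in `KZ.integrandAddRel`) and
  the identity `G = G₁ + G₂` is asked fibrewise over `T` only, like every other side condition.
* The derivative in `RawCovFamilyOn` is existential pointwise (`∃ L, HasFDerivWithinAt … L …`), as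
  in TameCovLimit; `mem_changeOfVariablesRel` chooses the field `Φ'` of `KZ.changeOfVariablesRel`.
* `UniformChainOn` allows integer coefficients (relations form a subgroup, so this is the natural
  hypothesis of a closure statement, as in `KZ.UniformlyEquivalentOn`); `TameUniformChainOn N`
  asks signs `±1`, at most `N` families, each `N`-tame — the shape of BoundedCost's certificates,
  one for all `t ∈ T`.
* Rescaling (`RawFamily.rescale`, `Raw*FamilyOn.rescale`, `RawMoveFamilyOn.rescale`,
  `UniformChainOn.rescale`, `setOf_mul_mem_Ioo`) moves a family over `Set.Ioo 0 δ`, `δ ∈ ℚ`, to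
  one over `Set.Ioo 0 1` with the same values `t ↦ M (δ t)`; tameness bounds are NOT preserved
  verbatim (the parameter coordinate is divided by `δ`), so a tame statement after rescaling needs
  the bound enlarged to `⌈N / δ⌉` — left to the user.
* What is NOT here: no facts. The existence of `L¹`-limits of tame families (item
  TameLimitExists), the closure lemmas and the squeeze are route items; Boolean operations on
  total domains (e.g. cutting a total domain down to the slab over `T`) are left to `--supports`
  lemmas of their provers (`IsSemialgebraicFunOn.comp_aeval`, `IsSemialgebraicMapOn.comp_aeval`,
  `IsSemialgebraic.inter` are the tools).
-/

noncomputable section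

open MeasureTheory Set Filter MvPolynomial
open scoped Topology
open Literature.ModelTheory.ExponentialFields (IsSemialgebraic)

namespace Literature.NumberTheory.Transcendental

/-! ### Pull-back of semialgebraic functions and maps along polynomial maps -/

section CompAeval

variable {k : Type*} {R : Type*} [CommRing k] [CommRing R] [LT R] [Algebra k R] {m m' n' : ℕ}

/-- **Pull-back of a semialgebraic function along a polynomial map.** If `f` is `k`-semialgebraic
on `s ⊆ R ^ m'` and `ψ : R ^ m → R ^ m'` is a polynomial map with coefficients in `k`, then
`f ∘ ψ` is `k`-semialgebraic on `ψ ⁻¹' s`: its graph is the preimage of the graph of `f` under the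
polynomial map `(x, y) ↦ (ψ x, y)` (no Tarski–Seidenberg needed). [BCR 1998, §2.2] [cite: BochnakCosteRoy1998, §2.2] -/
theorem IsSemialgebraicFunOn.comp_aeval {s : Set (Fin m' → R)} {f : (Fin m' → R) → R}
    (hf : IsSemialgebraicFunOn k s f) (P : Fin m' → MvPolynomial (Fin m) k) :
    IsSemialgebraicFunOn k ((fun x : Fin m → R => fun j => aeval x (P j)) ⁻¹' s)
      (fun x => f (fun j => aeval x (P j))) := by
  rw [isSemialgebraicFunOn_iff] at hf ⊢
  let Q : Fin (m' + 1) → MvPolynomial (Fin (m + 1)) k :=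
    Fin.snoc (fun j => rename Fin.castSucc (P j)) (X (Fin.last m))
  have hQ₁ : ∀ w : Fin (m + 1) → R,
      Fin.init (fun j => aeval w (Q j)) = fun j => aeval (Fin.init w) (P j) := by
    intro w
    funext j
    simp only [Fin.init, Q, Fin.snoc_castSucc, aeval_rename]
    rfl
  have hQ₂ : ∀ w : Fin (m + 1) → R, aeval w (Q (Fin.last m')) = w (Fin.last m) := by
    intro w
    simp [Q]
  convert hf.preimage_aeval Q using 1
  ext w
  simp only [mem_setOf_eq, mem_preimage, hQ₁, hQ₂]

/-- **Pull-back of a semialgebraic map along a polynomial map.** If `f : R ^ m' → R ^ n'` is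
`k`-semialgebraic on `s` and `ψ : R ^ m → R ^ m'` is a polynomial map with coefficients in `k`,
then `f ∘ ψ` is `k`-semialgebraic on `ψ ⁻¹' s` (graph = preimage of the graph under
`(x, y) ↦ (ψ x, y)`; no Tarski–Seidenberg needed). [BCR 1998, §2.2] [cite: BochnakCosteRoy1998, §2.2] -/
theorem IsSemialgebraicMapOn.comp_aeval {s : Set (Fin m' → R)} {f : (Fin m' → R) → (Fin n' → R)}
    (hf : IsSemialgebraicMapOn k s f) (P : Fin m' → MvPolynomial (Fin m) k) :
    IsSemialgebraicMapOn k ((fun x : Fin m → R => fun j => aeval x (P j)) ⁻¹' s)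
      (fun x => f (fun j => aeval x (P j))) := by
  rw [isSemialgebraicMapOn_iff] at hf ⊢
  let Q : Fin (m' + n') → MvPolynomial (Fin (m + n')) k :=
    Fin.append (fun j => rename (Fin.castAdd n') (P j)) (fun j => X (Fin.natAdd m j))
  have hQ₁ : ∀ u : Fin (m + n') → R, (fun i => aeval u (Q (Fin.castAdd n' i))) =
      fun j => aeval (fun i => u (Fin.castAdd n' i)) (P j) := by
    intro u
    funext i
    simp [Q, aeval_rename, Function.comp_def]
  have hQ₂ : ∀ u : Fin (m + n') → R,
      (fun j => aeval u (Q (Fin.natAdd m' j))) = fun j => u (Fin.natAdd m j) := by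
    intro u
    funext j
    simp [Q]
  convert hf.preimage_aeval Q using 1
  ext u
  simp only [mem_setOf_eq, mem_preimage, hQ₁, hQ₂]

end CompAeval

namespace KZ

variable {n m : ℕ}

/-! ### Raw pairs and raw families -/

/-- The free abelian group on ALL *raw pairs* `(σ ⊆ ℝᵏ, f : ℝᵏ → ℝ)` of all dimensions `k` (no
semialgebraicity or integrability asked): the group in which route InequalityCost's certificates
(BoundedCost) and uniform chains are written; its generators are `KZOver.Raw.gen k σ f`.
[Kontsevich–Zagier 2001, §1.2] [cite: KontsevichZagier2001, §1.2] -/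
abbrev RawGroup : Type := FreeAbelianGroup (Σ k : ℕ, Set (Fin k → ℝ) × ((Fin k → ℝ) → ℝ))

/-- The polynomial map `x ↦ (x, t)` (coefficients in `ℚ`) embedding `ℝⁿ` as the fibre over a
rational parameter `t`. [BCR 1998, §2.2] [cite: BochnakCosteRoy1998, §2.2] -/
def snocPoly (n : ℕ) (t : ℚ) : Fin (n + 1) → MvPolynomial (Fin n) ℚ :=
  Fin.snoc (fun i => X i) (C t)

/-- `snocPoly n t` evaluates to `x ↦ Fin.snoc x t`. [BCR 1998, §2.2] [cite: BochnakCosteRoy1998, §2.2] -/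
theorem aeval_snocPoly (t : ℚ) (x : Fin n → ℝ) :
    (fun j => aeval x (snocPoly n t j)) = Fin.snoc x (t : ℝ) := by
  funext j
  refine Fin.lastCases ?_ (fun i => ?_) j
  · simp [snocPoly, eq_ratCast]
  · simp [snocPoly]

/-- `snocPoly n t`, as a map in both arguments, evaluates to `(x, j) ↦ Fin.snoc x t j`.
[BCR 1998, §2.2] [cite: BochnakCosteRoy1998, §2.2] -/
theorem aeval_snocPoly' (t : ℚ) :
    (fun (x : Fin n → ℝ) (j : Fin (n + 1)) => aeval x (snocPoly n t j)) =
      fun x : Fin n → ℝ => (Fin.snoc x (t : ℝ) : Fin (n + 1) → ℝ) :=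
  funext (aeval_snocPoly t)

/-- The polynomial map `(x, t) ↦ (x, q t)` (coefficients in `ℚ`) rescaling the parameter by a
rational factor `q`. [BCR 1998, §2.2] [cite: BochnakCosteRoy1998, §2.2] -/
def rescalePoly (n : ℕ) (q : ℚ) : Fin (n + 1) → MvPolynomial (Fin (n + 1)) ℚ :=
  Fin.snoc (fun i => X (Fin.castSucc i)) (C q * X (Fin.last n))

/-- `rescalePoly n q` evaluates to `z ↦ (Fin.init z, q · z last)`. [BCR 1998, §2.2] [cite: BochnakCosteRoy1998, §2.2] -/
theorem aeval_rescalePoly (q : ℚ) (z : Fin (n + 1) → ℝ) :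
    (fun j => aeval z (rescalePoly n q j)) = Fin.snoc (Fin.init z) ((q : ℝ) * z (Fin.last n)) := by
  funext j
  refine Fin.lastCases ?_ (fun i => ?_) j
  · simp [rescalePoly, eq_ratCast]
  · simp [rescalePoly, Fin.init]

/-- `rescalePoly n q`, as a map in both arguments, evaluates to `(z, j) ↦ (Fin.init z, q · z last) j`.
[BCR 1998, §2.2] [cite: BochnakCosteRoy1998, §2.2] -/
theorem aeval_rescalePoly' (q : ℚ) :
    (fun (z : Fin (n + 1) → ℝ) (j : Fin (n + 1)) => aeval z (rescalePoly n q j)) =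
      fun z => Fin.snoc (Fin.init z) ((q : ℝ) * z (Fin.last n)) :=
  funext (aeval_rescalePoly q)

/-- A **`ℚ`-semialgebraic one-parameter family of raw pairs in dimension `n`**, given by its TOTAL
data: a `ℚ`-semialgebraic total domain `S ⊆ ℝⁿ⁺¹`, the parameter being the LAST coordinate, and
a total integrand `G` which is a `ℚ`-semialgebraic function on `S`. Its fibre at `t : ℝ` is the raw
pair `(S_t, G_t)` with `S_t = {x | (x, t) ∈ S}`, `G_t x = G (x, t)` (a definable family in the
sense of van den Dries: the fibres of one definable set).
[van den Dries 1998, Ch. 3 (3.1); Kontsevich–Zagier 2001, §1.2] [cite: Dries1998, Ch. 3 (3.1)] -/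
structure RawFamily (n : ℕ) where
  /-- The total domain `S ⊆ ℝⁿ⁺¹`; the parameter is the last coordinate. -/
  total : Set (Fin (n + 1) → ℝ)
  /-- The total integrand `G` (only its values on `total` matter). -/
  integrand : (Fin (n + 1) → ℝ) → ℝ
  /-- The total domain is `ℚ`-semialgebraic. -/
  isSemialgebraic_total : IsSemialgebraic ℚ total
  /-- The total integrand is a `ℚ`-semialgebraic function on the total domain. -/
  isSemialgebraicFunOn_integrand : IsSemialgebraicFunOn ℚ total integrand

namespace RawFamily

/-- The fibre `S_t = {x : ℝⁿ | (x, t) ∈ S}` of a raw family at the parameter `t` (verbatim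
`{x | Fin.snoc x t ∈ S}` as in the route items). [van den Dries 1998, Ch. 3 (3.1)] [cite: Dries1998, Ch. 3 (3.1)] -/
def fibre (S : RawFamily n) (t : ℝ) : Set (Fin n → ℝ) := {x : Fin n → ℝ | Fin.snoc x t ∈ S.total}

/-- The fibre integrand `G_t x = G (x, t)` of a raw family at the parameter `t` (not normalised off
the fibre). [van den Dries 1998, Ch. 3 (3.1)] [cite: Dries1998, Ch. 3 (3.1)] -/
def fibreFun (S : RawFamily n) (t : ℝ) : (Fin n → ℝ) → ℝ := fun x => S.integrand (Fin.snoc x t)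

/-- Membership in a fibre (definitional). [van den Dries 1998, Ch. 3 (3.1)] [cite: Dries1998, Ch. 3 (3.1)] -/
theorem mem_fibre (S : RawFamily n) (t : ℝ) (x : Fin n → ℝ) :
    x ∈ S.fibre t ↔ Fin.snoc x t ∈ S.total :=
  Iff.rfl

/-- The fibre integrand, evaluated (definitional). [van den Dries 1998, Ch. 3 (3.1)] [cite: Dries1998, Ch. 3 (3.1)] -/
theorem fibreFun_apply (S : RawFamily n) (t : ℝ) (x : Fin n → ℝ) :
    S.fibreFun t x = S.integrand (Fin.snoc x t) :=
  rfl

/-- The **raw generator of the fibre at `t`**: `[(S_t, 𝟙_{S_t} · G_t)]` in the free abelian group on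
raw pairs, the fibre integrand being extended by zero off the fibre (BoundedCost's normalisation
"zero off the domain"). [Kontsevich–Zagier 2001, §1.2] [cite: KontsevichZagier2001, §1.2] -/
def gen (S : RawFamily n) (t : ℝ) : RawGroup :=
  KZOver.Raw.gen n (S.fibre t) ((S.fibre t).indicator (S.fibreFun t))

/-- **Tameness** of a raw family with bound `N`: the total domain lies in the box `[−N, N]ⁿ⁺¹` and
the total integrand is bounded by `N` on it (verbatim the hypothesis of items TameLimitExists /
TameCovLimit). [Kontsevich–Zagier 2001, §1.2] [cite: KontsevichZagier2001, §1.2] -/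
def IsTame (N : ℕ) (S : RawFamily n) : Prop :=
  ∀ z ∈ S.total, (∀ i, |z i| ≤ N) ∧ |S.integrand z| ≤ N

/-- Tameness is monotone in the bound. [Kontsevich–Zagier 2001, §1.2] [cite: KontsevichZagier2001, §1.2] -/
theorem IsTame.mono {N N' : ℕ} {S : RawFamily n} (h : S.IsTame N) (hN : N ≤ N') : S.IsTame N' :=
  fun z hz => ⟨fun i => ((h z hz).1 i).trans (Nat.cast_le.mpr hN),
    (h z hz).2.trans (Nat.cast_le.mpr hN)⟩

/-- **`L¹`-limit at `0⁺`.** The raw family `(S_t, G_t)` converges in `L¹` (fibre integrands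
extended by zero) to the integral representation `r₀` as `t → 0⁺`:
`∫ |𝟙_{S_t} G_t − 𝟙_{σ₀} f₀| → 0`. Verbatim the conclusion of item TameLimitExists and the limit
hypotheses of TameCovLimit / TameNLLimit / AddLimits (`hasL1Limit_iff`). [folklore] -/
def HasL1Limit (S : RawFamily n) (r₀ : IntegralRep n) : Prop :=
  Tendsto (fun t : ℝ => ∫ x : Fin n → ℝ,
    |(S.fibre t).indicator (S.fibreFun t) x - r₀.domain.indicator r₀.integrand x|)
    (𝓝[>] (0 : ℝ)) (𝓝 0)

/-- Unfolding `HasL1Limit` into the clause inlined in the route items (definitional: `Iff.rfl`).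
[folklore] -/
theorem hasL1Limit_iff (S : RawFamily n) (r₀ : IntegralRep n) :
    S.HasL1Limit r₀ ↔ Tendsto (fun t : ℝ => ∫ x : Fin n → ℝ,
      |{x : Fin n → ℝ | Fin.snoc x t ∈ S.total}.indicator (fun x => S.integrand (Fin.snoc x t)) x -
        r₀.domain.indicator r₀.integrand x|) (𝓝[>] (0 : ℝ)) (𝓝 0) :=
  Iff.rfl

/-! #### Bridge to the ambient families of `KZMoveFamily.lean` -/

/-- The fibres of a raw family form a `ℚ`-semialgebraic family of sets over any parameter set, in
the (ambient) sense of `KZ.IsSemialgebraicSetFamilyOn` (the total domain is the ambient set).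
[van den Dries 1998, Ch. 3 (3.1)] [cite: Dries1998, Ch. 3 (3.1)] -/
theorem isSemialgebraicSetFamilyOn (S : RawFamily n) (T : Set ℝ) :
    IsSemialgebraicSetFamilyOn T S.fibre :=
  ⟨S.total, S.isSemialgebraic_total, fun _ _ => rfl⟩

/-- The total space over `T` of the fibres of a raw family lies in its total domain.
[van den Dries 1998, Ch. 3 (3.1)] [cite: Dries1998, Ch. 3 (3.1)] -/
theorem totalSet_fibre_subset (S : RawFamily n) (T : Set ℝ) : totalSet T S.fibre ⊆ S.total := by
  intro z hz
  have h : Fin.snoc (Fin.init z) (z (Fin.last n)) ∈ S.total := hz.2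
  rwa [Fin.snoc_init_self] at h

/-- The fibre integrands of a raw family form a `ℚ`-semialgebraic family of functions on its fibres
over any parameter set, in the (ambient) sense of `KZ.IsSemialgebraicFunFamilyOn`.
[van den Dries 1998, Ch. 3 (3.1)] [cite: Dries1998, Ch. 3 (3.1)] -/
theorem isSemialgebraicFunFamilyOn (S : RawFamily n) (T : Set ℝ) :
    IsSemialgebraicFunFamilyOn T S.fibre S.fibreFun :=
  ⟨S.total, S.integrand, S.isSemialgebraicFunOn_integrand, S.totalSet_fibre_subset T,
    fun _ _ _ _ => rfl⟩

/-! #### Fibres at rational parameters are `ℚ`-semialgebraic -/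

/-- The fibre of a raw family at a **rational** parameter is `ℚ`-semialgebraic (preimage of the
total domain under the polynomial map `x ↦ (x, t)`). [BCR 1998, §2.2] [cite: BochnakCosteRoy1998, §2.2] -/
theorem isSemialgebraic_fibre (S : RawFamily n) (t : ℚ) : IsSemialgebraic ℚ (S.fibre (t : ℝ)) := by
  have h := S.isSemialgebraic_total.preimage_aeval (snocPoly n t)
  simp only [aeval_snocPoly'] at h
  exact h

/-- The fibre integrand of a raw family at a **rational** parameter is a `ℚ`-semialgebraic function
on the fibre. [BCR 1998, §2.2] [cite: BochnakCosteRoy1998, §2.2] -/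
theorem isSemialgebraicFunOn_fibreFun (S : RawFamily n) (t : ℚ) :
    IsSemialgebraicFunOn ℚ (S.fibre (t : ℝ)) (S.fibreFun (t : ℝ)) := by
  have h := S.isSemialgebraicFunOn_integrand.comp_aeval (snocPoly n t)
  simp only [aeval_snocPoly, aeval_snocPoly'] at h
  exact h

/-- More generally: any `ℚ`-semialgebraic function on the total domain (e.g. the primitive or the
band bounds of a Newton–Leibniz family) has `ℚ`-semialgebraic fibre functions at rational
parameters. [BCR 1998, §2.2] [cite: BochnakCosteRoy1998, §2.2] -/
theorem isSemialgebraicFunOn_fibre_of_rat (S : RawFamily n) {F : (Fin (n + 1) → ℝ) → ℝ}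
    (hF : IsSemialgebraicFunOn ℚ S.total F) (t : ℚ) :
    IsSemialgebraicFunOn ℚ (S.fibre (t : ℝ)) (fun x => F (Fin.snoc x (t : ℝ))) := by
  have h := hF.comp_aeval (snocPoly n t)
  simp only [aeval_snocPoly, aeval_snocPoly'] at h
  exact h

/-- Any `ℚ`-semialgebraic map on the total domain (e.g. the change of variables of a `RawCovFamilyOn`)
has `ℚ`-semialgebraic fibre maps at rational parameters. [BCR 1998, §2.2] [cite: BochnakCosteRoy1998, §2.2] -/
theorem isSemialgebraicMapOn_fibre_of_rat (S : RawFamily n) {Φ : (Fin (n + 1) → ℝ) → (Fin m → ℝ)}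
    (hΦ : IsSemialgebraicMapOn ℚ S.total Φ) (t : ℚ) :
    IsSemialgebraicMapOn ℚ (S.fibre (t : ℝ)) (fun x => Φ (Fin.snoc x (t : ℝ))) := by
  have h := hΦ.comp_aeval (snocPoly n t)
  simp only [aeval_snocPoly, aeval_snocPoly'] at h
  exact h

/-! #### The constant family of an integral representation -/

/-- The **constant family** of an integral representation `r = (σ, f)`: total domain the cylinder
`σ × ℝ = {z | Fin.init z ∈ σ}`, total integrand `f ∘ Fin.init`; every fibre is `(σ, f)`.
[Kontsevich–Zagier 2001, §1.2] [cite: KontsevichZagier2001, §1.2] -/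
def const (r : IntegralRep n) : RawFamily n where
  total := {z | Fin.init z ∈ r.domain}
  integrand z := r.integrand (Fin.init z)
  isSemialgebraic_total := r.isSemialgebraic_domain.setOf_init_mem
  isSemialgebraicFunOn_integrand := r.isSemialgebraicFunOn_integrand.comp_init

/-- The fibres of the constant family are the domain. [Kontsevich–Zagier 2001, §1.2] [cite: KontsevichZagier2001, §1.2] -/
@[simp] theorem fibre_const (r : IntegralRep n) (t : ℝ) : (const r).fibre t = r.domain := by
  ext x
  simp [fibre, const]

/-- The fibre integrands of the constant family are the integrand. [Kontsevich–Zagier 2001, §1.2] [cite: KontsevichZagier2001, §1.2] -/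
@[simp] theorem fibreFun_const (r : IntegralRep n) (t : ℝ) : (const r).fibreFun t = r.integrand := by
  funext x
  simp [fibreFun, const]

/-- The raw generator of the constant family is `[(σ, 𝟙_σ f)]` at every parameter.
[Kontsevich–Zagier 2001, §1.2] [cite: KontsevichZagier2001, §1.2] -/
theorem gen_const (r : IntegralRep n) (t : ℝ) :
    (const r).gen t = KZOver.Raw.gen n r.domain (r.domain.indicator r.integrand) := by
  simp [gen]

/-- A constant family converges in `L¹` to its representation (non-vacuity of `HasL1Limit`).
[folklore] -/
theorem hasL1Limit_const (r : IntegralRep n) : (const r).HasL1Limit r := by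
  simp only [HasL1Limit, fibre_const, fibreFun_const, sub_self, abs_zero, integral_zero]
  exact tendsto_const_nhds

/-- The fibre integrands of the constant family of a representation with integrand bounded by `N`
are bounded by `N` (the total domain of `const r` is the full cylinder `σ × ℝ`, so `const r`
itself is `N`-tame only after cutting the parameter down to `|t| ≤ N`; limits only see fibres).
[Kontsevich–Zagier 2001, §1.2] [cite: KontsevichZagier2001, §1.2] -/
theorem abs_fibreFun_const_le (r : IntegralRep n) {N : ℕ} (h : ∀ x ∈ r.domain, |r.integrand x| ≤ N)
    (t : ℝ) : ∀ x ∈ (const r).fibre t, |(const r).fibreFun t x| ≤ N := by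
  simpa using h

/-! #### Rescaling the parameter by a rational factor -/

/-- **Rescaling** a raw family by a rational factor `q`: the family `t ↦ (S_{q t}, G_{q t})`, with
total domain `{(x, t) | (x, q t) ∈ S}` and total integrand `(x, t) ↦ G (x, q t)` (pull-backs along
the polynomial map `(x, t) ↦ (x, q t)`, hence again `ℚ`-semialgebraic). Used to move a parameter
interval `(0, δ)`, `δ ∈ ℚ`, to `(0, 1)`. [van den Dries 1998, Ch. 3 (3.1)] [cite: Dries1998, Ch. 3 (3.1)] -/
def rescale (q : ℚ) (S : RawFamily n) : RawFamily n where
  total := {z | Fin.snoc (Fin.init z) ((q : ℝ) * z (Fin.last n)) ∈ S.total}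
  integrand z := S.integrand (Fin.snoc (Fin.init z) ((q : ℝ) * z (Fin.last n)))
  isSemialgebraic_total := by
    have h := S.isSemialgebraic_total.preimage_aeval (rescalePoly n q)
    simp only [aeval_rescalePoly'] at h
    exact h
  isSemialgebraicFunOn_integrand := by
    have h := S.isSemialgebraicFunOn_integrand.comp_aeval (rescalePoly n q)
    simp only [aeval_rescalePoly, aeval_rescalePoly'] at h
    exact h

/-- The fibres of the rescaled family: `(rescale q S)_t = S_{q t}`. [van den Dries 1998, Ch. 3 (3.1)] [cite: Dries1998, Ch. 3 (3.1)] -/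
@[simp] theorem fibre_rescale (q : ℚ) (S : RawFamily n) (t : ℝ) :
    (S.rescale q).fibre t = S.fibre ((q : ℝ) * t) := by
  ext x
  simp [fibre, rescale]

/-- The fibre integrands of the rescaled family: `(rescale q S).fibreFun t = G_{q t}`.
[van den Dries 1998, Ch. 3 (3.1)] [cite: Dries1998, Ch. 3 (3.1)] -/
@[simp] theorem fibreFun_rescale (q : ℚ) (S : RawFamily n) (t : ℝ) :
    (S.rescale q).fibreFun t = S.fibreFun ((q : ℝ) * t) := by
  funext x
  simp [fibreFun, rescale]

/-- The raw generators of the rescaled family: `(rescale q S).gen t = S.gen (q t)`.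
[van den Dries 1998, Ch. 3 (3.1)] [cite: Dries1998, Ch. 3 (3.1)] -/
@[simp] theorem gen_rescale (q : ℚ) (S : RawFamily n) (t : ℝ) :
    (S.rescale q).gen t = S.gen ((q : ℝ) * t) := by
  simp [gen]

/-- `L¹`-limits at `0⁺` are preserved by rescaling with a positive rational factor.
[folklore] -/
theorem HasL1Limit.rescale {S : RawFamily n} {r₀ : IntegralRep n} (h : S.HasL1Limit r₀) {q : ℚ}
    (hq : 0 < q) : (S.rescale q).HasL1Limit r₀ := by
  simp only [HasL1Limit, fibre_rescale, fibreFun_rescale]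
  have hq' : (0 : ℝ) < q := by exact_mod_cast hq
  have h0 : Tendsto (fun t : ℝ => (q : ℝ) * t) (𝓝 (0 : ℝ)) (𝓝 0) := by
    simpa using (continuous_const_mul (q : ℝ)).tendsto (0 : ℝ)
  have ht : Tendsto (fun t : ℝ => (q : ℝ) * t) (𝓝[>] (0 : ℝ)) (𝓝[>] (0 : ℝ)) :=
    tendsto_nhdsWithin_of_tendsto_nhds_of_eventually_within _ (h0.mono_left nhdsWithin_le_nhds)
      (by filter_upwards [self_mem_nhdsWithin] with t ht using mul_pos hq' ht)
  exact h.comp ht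

end RawFamily

/-! ### Families of instances of the four moves -/

/-- A **family over `T ⊆ ℝ` of instances of move (1a), additivity in the domain**: raw families
`whole = (S, G)`, `left = (S₁, G₁)`, `right = (S₂, G₂)` in dimension `n` such that for every
`t ∈ T`: `S_t = S₁_t ∪ S₂_t`, the overlap `S₁_t ∩ S₂_t` is Lebesgue-null, and `G_t` agrees with
`G₁_t` on `S₁_t` and with `G₂_t` on `S₂_t` (the side conditions of `KZ.domainAddRel`, verbatim
those of item AddLimits, first half). [Kontsevich–Zagier 2001, §1.2, rule (1)] [cite: KontsevichZagier2001, §1.2 rule (1)] -/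
structure RawDomainAddFamilyOn (T : Set ℝ) (n : ℕ) where
  /-- The family of the whole representations `(S, G)`. -/
  whole : RawFamily n
  /-- The family of the first pieces `(S₁, G₁)`. -/
  left : RawFamily n
  /-- The family of the second pieces `(S₂, G₂)`. -/
  right : RawFamily n
  /-- Fibrewise `S_t = S₁_t ∪ S₂_t`. -/
  fibre_eq : ∀ t ∈ T, whole.fibre t = left.fibre t ∪ right.fibre t
  /-- Fibrewise the overlap is Lebesgue-null. -/
  volume_inter : ∀ t ∈ T, volume (left.fibre t ∩ right.fibre t) = 0
  /-- Fibrewise `G_t = G₁_t` on `S₁_t`. -/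
  eqOn_left : ∀ t ∈ T, EqOn (whole.fibreFun t) (left.fibreFun t) (left.fibre t)
  /-- Fibrewise `G_t = G₂_t` on `S₂_t`. -/
  eqOn_right : ∀ t ∈ T, EqOn (whole.fibreFun t) (right.fibreFun t) (right.fibre t)

namespace RawDomainAddFamilyOn

variable {T T' : Set ℝ}

/-- The value at `t` of a domain-additivity family: `[S_t] − [S₁_t] − [S₂_t]` in the raw group.
[Kontsevich–Zagier 2001, §1.2, rule (1)] [cite: KontsevichZagier2001, §1.2 rule (1)] -/
def gen (M : RawDomainAddFamilyOn T n) (t : ℝ) : RawGroup :=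
  M.whole.gen t - M.left.gen t - M.right.gen t

/-- Tameness with bound `N`: dimension `n ≤ N` and the three raw families are `N`-tame.
[Kontsevich–Zagier 2001, §1.2] [cite: KontsevichZagier2001, §1.2] -/
def IsTame (N : ℕ) (M : RawDomainAddFamilyOn T n) : Prop :=
  n ≤ N ∧ M.whole.IsTame N ∧ M.left.IsTame N ∧ M.right.IsTame N

/-- Restriction of the parameter set. [Kontsevich–Zagier 2001, §1.2] [cite: KontsevichZagier2001, §1.2] -/
def restrict (M : RawDomainAddFamilyOn T n) (h : T' ⊆ T) : RawDomainAddFamilyOn T' n where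
  whole := M.whole
  left := M.left
  right := M.right
  fibre_eq t ht := M.fibre_eq t (h ht)
  volume_inter t ht := M.volume_inter t (h ht)
  eqOn_left t ht := M.eqOn_left t (h ht)
  eqOn_right t ht := M.eqOn_right t (h ht)

/-- **Fibre extraction for move (1a).** If integral representations `r`, `r₁`, `r₂` realise the
fibre data of a domain-additivity family at `t ∈ T` (same domains, integrands agreeing on them),
then `[r] − [r₁] − [r₂] ∈ KZ.domainAddRel`. [Kontsevich–Zagier 2001, §1.2, rule (1)] [cite: KontsevichZagier2001, §1.2 rule (1)] -/
theorem mem_domainAddRel (M : RawDomainAddFamilyOn T n) {t : ℝ} (ht : t ∈ T)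
    (r r₁ r₂ : IntegralRep n) (hr : r.domain = M.whole.fibre t) (hr₁ : r₁.domain = M.left.fibre t)
    (hr₂ : r₂.domain = M.right.fibre t) (hf : EqOn r.integrand (M.whole.fibreFun t) r.domain)
    (hf₁ : EqOn r₁.integrand (M.left.fibreFun t) r₁.domain)
    (hf₂ : EqOn r₂.integrand (M.right.fibreFun t) r₂.domain) :
    of r - of r₁ - of r₂ ∈ domainAddRel := by
  refine ⟨n, r, r₁, r₂, ?_, ?_, ?_, ?_, rfl⟩
  · rw [hr, hr₁, hr₂]; exact M.fibre_eq t ht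
  · rw [hr₁, hr₂]; exact M.volume_inter t ht
  · intro x hx
    have hx' : x ∈ M.left.fibre t := hr₁ ▸ hx
    have hxr : x ∈ r.domain := by rw [hr, M.fibre_eq t ht]; exact Or.inl hx'
    rw [hf hxr, hf₁ hx, M.eqOn_left t ht hx']
  · intro x hx
    have hx' : x ∈ M.right.fibre t := hr₂ ▸ hx
    have hxr : x ∈ r.domain := by rw [hr, M.fibre_eq t ht]; exact Or.inr hx'
    rw [hf hxr, hf₂ hx, M.eqOn_right t ht hx']

end RawDomainAddFamilyOn

/-- A **family over `T ⊆ ℝ` of instances of move (1b), additivity in the integrand**: raw families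
`whole = (S, G)`, `left = (S, G₁)`, `right = (S, G₂)` in dimension `n` with the SAME total domain
such that for every `t ∈ T`, `G_t = G₁_t + G₂_t` on `S_t` (the side conditions of
`KZ.integrandAddRel`; item AddLimits, second half, asks the identity on the total space).
[Kontsevich–Zagier 2001, §1.2, rule (1)] [cite: KontsevichZagier2001, §1.2 rule (1)] -/
structure RawIntegrandAddFamilyOn (T : Set ℝ) (n : ℕ) where
  /-- The family of the whole representations `(S, G)`. -/
  whole : RawFamily n
  /-- The family `(S, G₁)`. -/
  left : RawFamily n
  /-- The family `(S, G₂)`. -/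
  right : RawFamily n
  /-- Same total domain for `G₁`. -/
  total_left : left.total = whole.total
  /-- Same total domain for `G₂`. -/
  total_right : right.total = whole.total
  /-- Fibrewise `G_t = G₁_t + G₂_t` on `S_t`. -/
  eqOn_add : ∀ t ∈ T, EqOn (whole.fibreFun t) (left.fibreFun t + right.fibreFun t) (whole.fibre t)

namespace RawIntegrandAddFamilyOn

variable {T T' : Set ℝ}

/-- The value at `t` of an integrand-additivity family: `[S_t, G_t] − [S_t, G₁_t] − [S_t, G₂_t]`.
[Kontsevich–Zagier 2001, §1.2, rule (1)] [cite: KontsevichZagier2001, §1.2 rule (1)] -/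
def gen (M : RawIntegrandAddFamilyOn T n) (t : ℝ) : RawGroup :=
  M.whole.gen t - M.left.gen t - M.right.gen t

/-- Tameness with bound `N`: dimension `n ≤ N` and the three raw families are `N`-tame.
[Kontsevich–Zagier 2001, §1.2] [cite: KontsevichZagier2001, §1.2] -/
def IsTame (N : ℕ) (M : RawIntegrandAddFamilyOn T n) : Prop :=
  n ≤ N ∧ M.whole.IsTame N ∧ M.left.IsTame N ∧ M.right.IsTame N

/-- The fibres of `left` are those of `whole`. [Kontsevich–Zagier 2001, §1.2] [cite: KontsevichZagier2001, §1.2] -/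
@[simp] theorem fibre_left (M : RawIntegrandAddFamilyOn T n) (t : ℝ) : M.left.fibre t = M.whole.fibre t := by
  simp [RawFamily.fibre, M.total_left]

/-- The fibres of `right` are those of `whole`. [Kontsevich–Zagier 2001, §1.2] [cite: KontsevichZagier2001, §1.2] -/
@[simp] theorem fibre_right (M : RawIntegrandAddFamilyOn T n) (t : ℝ) :
    M.right.fibre t = M.whole.fibre t := by
  simp [RawFamily.fibre, M.total_right]

/-- Restriction of the parameter set. [Kontsevich–Zagier 2001, §1.2] [cite: KontsevichZagier2001, §1.2] -/
def restrict (M : RawIntegrandAddFamilyOn T n) (h : T' ⊆ T) : RawIntegrandAddFamilyOn T' n where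
  whole := M.whole
  left := M.left
  right := M.right
  total_left := M.total_left
  total_right := M.total_right
  eqOn_add t ht := M.eqOn_add t (h ht)

/-- **Fibre extraction for move (1b).** If integral representations `r`, `r₁`, `r₂` with the same
domain realise the fibre data of an integrand-additivity family at `t ∈ T`, then
`[r] − [r₁] − [r₂] ∈ KZ.integrandAddRel`. [Kontsevich–Zagier 2001, §1.2, rule (1)] [cite: KontsevichZagier2001, §1.2 rule (1)] -/
theorem mem_integrandAddRel (M : RawIntegrandAddFamilyOn T n) {t : ℝ} (ht : t ∈ T)
    (r r₁ r₂ : IntegralRep n) (hr : r.domain = M.whole.fibre t) (hr₁ : r₁.domain = r.domain)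
    (hr₂ : r₂.domain = r.domain) (hf : EqOn r.integrand (M.whole.fibreFun t) r.domain)
    (hf₁ : EqOn r₁.integrand (M.left.fibreFun t) r.domain)
    (hf₂ : EqOn r₂.integrand (M.right.fibreFun t) r.domain) :
    of r - of r₁ - of r₂ ∈ integrandAddRel := by
  refine ⟨n, r, r₁, r₂, hr₁, hr₂, fun x hx => ?_, rfl⟩
  rw [Pi.add_apply, hf hx, hf₁ hx, hf₂ hx]
  exact M.eqOn_add t ht (hr ▸ hx)

end RawIntegrandAddFamilyOn

/-- A **family over `T ⊆ ℝ` of instances of move (2), change of variables**: raw families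
`source = (S, G)`, `target = (S', G')` in dimension `n` and a total change of variables
`Φ : ℝⁿ⁺¹ → ℝⁿ`, `ℚ`-semialgebraic on `S`, such that for every `t ∈ T` the fibre map
`φ_t = Φ (·, t)` is injective on `S_t` with image `S'_t`, and at every `x ∈ S_t` has a derivative
`L` within `S_t` with `G_t x = G'_t (φ_t x) · |det L|` (the side conditions of
`KZ.changeOfVariablesRel` with the derivative existential pointwise — verbatim those of item
TameCovLimit). [Kontsevich–Zagier 2001, §1.2, rule (2)] [cite: KontsevichZagier2001, §1.2 rule (2)] -/
structure RawCovFamilyOn (T : Set ℝ) (n : ℕ) where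
  /-- The family of sources `(S, G)`. -/
  source : RawFamily n
  /-- The family of targets `(S', G')`. -/
  target : RawFamily n
  /-- The total change of variables `Φ (x, t) = φ_t x`. -/
  map : (Fin (n + 1) → ℝ) → (Fin n → ℝ)
  /-- `Φ` is a `ℚ`-semialgebraic map on the total source domain. -/
  isSemialgebraicMapOn_map : IsSemialgebraicMapOn ℚ source.total map
  /-- Fibrewise injectivity of `φ_t` on `S_t`. -/
  injOn : ∀ t ∈ T, InjOn (fun x => map (Fin.snoc x t)) (source.fibre t)
  /-- Fibrewise `φ_t (S_t) = S'_t`. -/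
  image_eq : ∀ t ∈ T, (fun x => map (Fin.snoc x t)) '' source.fibre t = target.fibre t
  /-- Fibrewise differentiability within `S_t` and the Jacobian identity. -/
  hasFDerivWithinAt : ∀ t ∈ T, ∀ x ∈ source.fibre t, ∃ L : (Fin n → ℝ) →L[ℝ] (Fin n → ℝ),
    HasFDerivWithinAt (fun x => map (Fin.snoc x t)) L (source.fibre t) x ∧
      source.fibreFun t x = target.fibreFun t (map (Fin.snoc x t)) * |L.det|

namespace RawCovFamilyOn

variable {T T' : Set ℝ}

/-- The fibre change of variables `φ_t = Φ (·, t)`. [Kontsevich–Zagier 2001, §1.2, rule (2)] [cite: KontsevichZagier2001, §1.2 rule (2)] -/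
def fibreMap (M : RawCovFamilyOn T n) (t : ℝ) : (Fin n → ℝ) → (Fin n → ℝ) := fun x => M.map (Fin.snoc x t)

/-- The fibre map, evaluated (definitional). [Kontsevich–Zagier 2001, §1.2, rule (2)] [cite: KontsevichZagier2001, §1.2 rule (2)] -/
@[simp] theorem fibreMap_apply (M : RawCovFamilyOn T n) (t : ℝ) (x : Fin n → ℝ) :
    M.fibreMap t x = M.map (Fin.snoc x t) :=
  rfl

/-- The value at `t` of a change-of-variables family: `[S_t, G_t] − [S'_t, G'_t]`.
[Kontsevich–Zagier 2001, §1.2, rule (2)] [cite: KontsevichZagier2001, §1.2 rule (2)] -/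
def gen (M : RawCovFamilyOn T n) (t : ℝ) : RawGroup :=
  M.source.gen t - M.target.gen t

/-- Tameness with bound `N`: dimension `n ≤ N`, source and target `N`-tame (the Jacobian is NOT
bounded, as in item TameCovLimit). [Kontsevich–Zagier 2001, §1.2] [cite: KontsevichZagier2001, §1.2] -/
def IsTame (N : ℕ) (M : RawCovFamilyOn T n) : Prop :=
  n ≤ N ∧ M.source.IsTame N ∧ M.target.IsTame N

/-- Restriction of the parameter set. [Kontsevich–Zagier 2001, §1.2] [cite: KontsevichZagier2001, §1.2] -/
def restrict (M : RawCovFamilyOn T n) (h : T' ⊆ T) : RawCovFamilyOn T' n where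
  source := M.source
  target := M.target
  map := M.map
  isSemialgebraicMapOn_map := M.isSemialgebraicMapOn_map
  injOn t ht := M.injOn t (h ht)
  image_eq t ht := M.image_eq t (h ht)
  hasFDerivWithinAt t ht := M.hasFDerivWithinAt t (h ht)

/-- The fibre map at a **rational** parameter is a `ℚ`-semialgebraic map on the fibre.
[BCR 1998, §2.2] [cite: BochnakCosteRoy1998, §2.2] -/
theorem isSemialgebraicMapOn_fibreMap (M : RawCovFamilyOn T n) (t : ℚ) :
    IsSemialgebraicMapOn ℚ (M.source.fibre (t : ℝ)) (M.fibreMap (t : ℝ)) :=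
  M.source.isSemialgebraicMapOn_fibre_of_rat M.isSemialgebraicMapOn_map t

/-- The fibre maps of a raw change-of-variables family form a `ℚ`-semialgebraic family of maps on
the source fibres over any parameter set, in the (ambient) sense of `KZ.IsSemialgebraicMapFamilyOn`.
[van den Dries 1998, Ch. 3 (3.1)] [cite: Dries1998, Ch. 3 (3.1)] -/
theorem isSemialgebraicMapFamilyOn (M : RawCovFamilyOn T n) (T' : Set ℝ) :
    IsSemialgebraicMapFamilyOn T' M.source.fibre M.fibreMap :=
  ⟨M.source.total, M.map, M.isSemialgebraicMapOn_map, M.source.totalSet_fibre_subset T',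
    fun _ _ _ _ => rfl⟩

/-- **Fibre extraction for move (2).** If integral representations `r`, `r'` realise the fibre
data of a change-of-variables family at `t ∈ T` and the fibre map `φ_t` is `ℚ`-semialgebraic on
`S_t` (automatic for `t ∈ ℚ`, `isSemialgebraicMapOn_fibreMap`), then
`[r] − [r'] ∈ KZ.changeOfVariablesRel` (the derivative field is chosen pointwise).
[Kontsevich–Zagier 2001, §1.2, rule (2)] [cite: KontsevichZagier2001, §1.2 rule (2)] -/
theorem mem_changeOfVariablesRel (M : RawCovFamilyOn T n) {t : ℝ} (ht : t ∈ T)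
    (r r' : IntegralRep n) (hr : r.domain = M.source.fibre t) (hr' : r'.domain = M.target.fibre t)
    (hf : EqOn r.integrand (M.source.fibreFun t) r.domain)
    (hf' : EqOn r'.integrand (M.target.fibreFun t) r'.domain)
    (hΦ : IsSemialgebraicMapOn ℚ r.domain (M.fibreMap t)) :
    of r - of r' ∈ changeOfVariablesRel := by
  classical
  choose! L hL using M.hasFDerivWithinAt t ht
  refine ⟨n, r, r', M.fibreMap t, L, hΦ, ?_, ?_, ?_, ?_, rfl⟩
  · rw [hr]
    exact fun x hx => (hL x hx).1
  · rw [hr]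
    exact M.injOn t ht
  · rw [hr, hr']
    exact (M.image_eq t ht).symm
  · intro x hx
    have hx' : x ∈ M.source.fibre t := hr ▸ hx
    have hΦx : M.fibreMap t x ∈ r'.domain := by
      rw [hr', ← M.image_eq t ht]
      exact mem_image_of_mem _ hx'
    rw [hf hx, hf' hΦx]
    exact (hL x hx').2

end RawCovFamilyOn

/-- A **family over `T ⊆ ℝ` of instances of move (3), Newton–Leibniz along the last coordinate**:
a raw family `band = (B, G)` in dimension `n + 1` (total points `(x, s, t)`: `s` the integration
variable, `t` the parameter), a raw family `base = (T₀, H)` in dimension `n` (total points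
`(x, t)`), a total primitive `F` (`ℚ`-semialgebraic on `B`) and total band bounds `a`, `b`
(`ℚ`-semialgebraic on `T₀`) such that for every `t ∈ T`: `a_t ≤ b_t` on the base fibre, the band
fibre is `{(x, s) | x ∈ (T₀)_t, a_t x ≤ s ≤ b_t x}`, `s ↦ F_t (x, s)` is continuous on
`[a_t x, b_t x]` with derivative `G_t (x, s)` on the open interval, and
`H_t x = F_t (x, b_t x) − F_t (x, a_t x)` (the side conditions of `KZ.newtonLeibnizRel`, verbatim
those of item TameNLLimit). [Kontsevich–Zagier 2001, §1.2, rule (3)] [cite: KontsevichZagier2001, §1.2 rule (3)] -/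
structure RawNLFamilyOn (T : Set ℝ) (n : ℕ) where
  /-- The family of bands `(B, G)` in dimension `n + 1`. -/
  band : RawFamily (n + 1)
  /-- The family of bases `(T₀, H)` in dimension `n`. -/
  base : RawFamily n
  /-- The total primitive `F (x, s, t) = F_t (x, s)`. -/
  prim : (Fin (n + 2) → ℝ) → ℝ
  /-- The total lower band bound `a (x, t) = a_t x`. -/
  lower : (Fin (n + 1) → ℝ) → ℝ
  /-- The total upper band bound `b (x, t) = b_t x`. -/
  upper : (Fin (n + 1) → ℝ) → ℝ
  /-- `F` is `ℚ`-semialgebraic on the total band. -/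
  isSemialgebraicFunOn_prim : IsSemialgebraicFunOn ℚ band.total prim
  /-- `a` is `ℚ`-semialgebraic on the total base. -/
  isSemialgebraicFunOn_lower : IsSemialgebraicFunOn ℚ base.total lower
  /-- `b` is `ℚ`-semialgebraic on the total base. -/
  isSemialgebraicFunOn_upper : IsSemialgebraicFunOn ℚ base.total upper
  /-- Fibrewise `a_t ≤ b_t` on the base fibre. -/
  lower_le_upper : ∀ t ∈ T, ∀ x ∈ base.fibre t, lower (Fin.snoc x t) ≤ upper (Fin.snoc x t)
  /-- Fibrewise the band fibre is the band of `a_t ≤ b_t` over the base fibre. -/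
  fibre_band : ∀ t ∈ T, band.fibre t = {w : Fin (n + 1) → ℝ | Fin.init w ∈ base.fibre t ∧
    lower (Fin.snoc (Fin.init w) t) ≤ w (Fin.last n) ∧ w (Fin.last n) ≤ upper (Fin.snoc (Fin.init w) t)}
  /-- Fibrewise continuity of `s ↦ F_t (x, s)` on the closed interval. -/
  continuousOn : ∀ t ∈ T, ∀ x ∈ base.fibre t,
    ContinuousOn (fun s : ℝ => prim (Fin.snoc (Fin.snoc x s) t))
      (Icc (lower (Fin.snoc x t)) (upper (Fin.snoc x t)))
  /-- Fibrewise `∂/∂s F_t (x, s) = G_t (x, s)` on the open interval. -/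
  hasDerivAt : ∀ t ∈ T, ∀ x ∈ base.fibre t, ∀ s ∈ Ioo (lower (Fin.snoc x t)) (upper (Fin.snoc x t)),
    HasDerivAt (fun s : ℝ => prim (Fin.snoc (Fin.snoc x s) t)) (band.integrand (Fin.snoc (Fin.snoc x s) t)) s
  /-- Fibrewise `H_t x = F_t (x, b_t x) − F_t (x, a_t x)` on the base fibre. -/
  base_eq : ∀ t ∈ T, ∀ x ∈ base.fibre t, base.integrand (Fin.snoc x t) =
    prim (Fin.snoc (Fin.snoc x (upper (Fin.snoc x t))) t) -
      prim (Fin.snoc (Fin.snoc x (lower (Fin.snoc x t))) t)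

namespace RawNLFamilyOn

variable {T T' : Set ℝ}

/-- The value at `t` of a Newton–Leibniz family: `[B_t, G_t] − [(T₀)_t, H_t]`.
[Kontsevich–Zagier 2001, §1.2, rule (3)] [cite: KontsevichZagier2001, §1.2 rule (3)] -/
def gen (M : RawNLFamilyOn T n) (t : ℝ) : RawGroup :=
  M.band.gen t - M.base.gen t

/-- Tameness with bound `N`: band dimension `n + 1 ≤ N`, band and base `N`-tame, and the primitive
bounded by `N` on the total band (renormalised primitives, as in item TameNLLimit).
[Kontsevich–Zagier 2001, §1.2] [cite: KontsevichZagier2001, §1.2] -/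
def IsTame (N : ℕ) (M : RawNLFamilyOn T n) : Prop :=
  n + 1 ≤ N ∧ M.band.IsTame N ∧ (∀ z ∈ M.band.total, |M.prim z| ≤ N) ∧ M.base.IsTame N

/-- Restriction of the parameter set. [Kontsevich–Zagier 2001, §1.2] [cite: KontsevichZagier2001, §1.2] -/
def restrict (M : RawNLFamilyOn T n) (h : T' ⊆ T) : RawNLFamilyOn T' n where
  band := M.band
  base := M.base
  prim := M.prim
  lower := M.lower
  upper := M.upper
  isSemialgebraicFunOn_prim := M.isSemialgebraicFunOn_prim
  isSemialgebraicFunOn_lower := M.isSemialgebraicFunOn_lower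
  isSemialgebraicFunOn_upper := M.isSemialgebraicFunOn_upper
  lower_le_upper t ht := M.lower_le_upper t (h ht)
  fibre_band t ht := M.fibre_band t (h ht)
  continuousOn t ht := M.continuousOn t (h ht)
  hasDerivAt t ht := M.hasDerivAt t (h ht)
  base_eq t ht := M.base_eq t (h ht)

/-- **Fibre extraction for move (3).** If integral representations `r` (band) and `r'` (base)
realise the fibre data of a Newton–Leibniz family at `t ∈ T`, and the fibre primitive `F_t` and
band bounds `a_t`, `b_t` are `ℚ`-semialgebraic on them (automatic for `t ∈ ℚ`,
`RawFamily.isSemialgebraicFunOn_fibre_of_rat`), then `[r] − [r'] ∈ KZ.newtonLeibnizRel`.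
[Kontsevich–Zagier 2001, §1.2, rule (3)] [cite: KontsevichZagier2001, §1.2 rule (3)] -/
theorem mem_newtonLeibnizRel (M : RawNLFamilyOn T n) {t : ℝ} (ht : t ∈ T)
    (r : IntegralRep (n + 1)) (r' : IntegralRep n) (hr : r.domain = M.band.fibre t)
    (hr' : r'.domain = M.base.fibre t) (hf : EqOn r.integrand (M.band.fibreFun t) r.domain)
    (hf' : EqOn r'.integrand (M.base.fibreFun t) r'.domain)
    (hF : IsSemialgebraicFunOn ℚ r.domain (fun w => M.prim (Fin.snoc w t)))
    (ha : IsSemialgebraicFunOn ℚ r'.domain (fun x => M.lower (Fin.snoc x t)))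
    (hb : IsSemialgebraicFunOn ℚ r'.domain (fun x => M.upper (Fin.snoc x t))) :
    of r - of r' ∈ newtonLeibnizRel := by
  refine ⟨n, r, r', fun x => M.lower (Fin.snoc x t), fun x => M.upper (Fin.snoc x t),
    fun w => M.prim (Fin.snoc w t), hF, ha, hb, ?_, ?_, ?_, ?_, ?_, rfl⟩
  · intro x hx
    exact M.lower_le_upper t ht x (hr' ▸ hx)
  · rw [hr, hr']
    exact M.fibre_band t ht
  · intro x hx
    exact M.continuousOn t ht x (hr' ▸ hx)
  · intro x hx s hs
    have hx' : x ∈ M.base.fibre t := hr' ▸ hx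
    have hxs : Fin.snoc x s ∈ r.domain := by
      rw [hr, M.fibre_band t ht]
      simp only [mem_setOf_eq, Fin.init_snoc, Fin.snoc_last]
      exact ⟨hx', hs.1.le, hs.2.le⟩
    rw [hf hxs]
    exact M.hasDerivAt t ht x hx' s hs
  · intro x hx
    rw [hf' hx]
    exact M.base_eq t ht x (hr' ▸ hx)

end RawNLFamilyOn

/-! ### Move families, uniform chains, tameness -/

/-- A **move family over `T ⊆ ℝ`**: a `ℚ`-semialgebraic family, over the parameter set `T`, of
instances of ONE of the four moves of the Kontsevich–Zagier calculus (domain additivity, integrand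
additivity, change of variables, Newton–Leibniz), in some dimension.
[Kontsevich–Zagier 2001, §1.2] [cite: KontsevichZagier2001, §1.2] -/
inductive RawMoveFamilyOn (T : Set ℝ) : Type
  /-- A family of domain-additivity instances. -/
  | domainAdd {n : ℕ} (M : RawDomainAddFamilyOn T n) : RawMoveFamilyOn T
  /-- A family of integrand-additivity instances. -/
  | integrandAdd {n : ℕ} (M : RawIntegrandAddFamilyOn T n) : RawMoveFamilyOn T
  /-- A family of change-of-variables instances. -/
  | cov {n : ℕ} (M : RawCovFamilyOn T n) : RawMoveFamilyOn T
  /-- A family of Newton–Leibniz instances. -/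
  | newtonLeibniz {n : ℕ} (M : RawNLFamilyOn T n) : RawMoveFamilyOn T

namespace RawMoveFamilyOn

variable {T T' : Set ℝ}

/-- The value `M(t)` of a move family at the parameter `t`: the formal combination of its fibre raw
pairs (`[r] − [r₁] − [r₂]`, resp. `[r] − [r']`) in the raw group.
[Kontsevich–Zagier 2001, §1.2] [cite: KontsevichZagier2001, §1.2] -/
def gen : RawMoveFamilyOn T → ℝ → RawGroup
  | domainAdd M, t => M.gen t
  | integrandAdd M, t => M.gen t
  | cov M, t => M.gen t
  | newtonLeibniz M, t => M.gen t

/-- **Tameness** `IsTame N`: all dimensions `≤ N`, all domains in `[−N, N]ᵏ`, all integrands and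
the primitive bounded by `N` (the tameness of route InequalityCost, per move kind).
[Kontsevich–Zagier 2001, §1.2] [cite: KontsevichZagier2001, §1.2] -/
def IsTame (N : ℕ) : RawMoveFamilyOn T → Prop
  | domainAdd M => M.IsTame N
  | integrandAdd M => M.IsTame N
  | cov M => M.IsTame N
  | newtonLeibniz M => M.IsTame N

/-- Restriction of a move family to a smaller parameter set. [Kontsevich–Zagier 2001, §1.2] [cite: KontsevichZagier2001, §1.2] -/
def restrict (h : T' ⊆ T) : RawMoveFamilyOn T → RawMoveFamilyOn T'
  | domainAdd M => domainAdd (M.restrict h)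
  | integrandAdd M => integrandAdd (M.restrict h)
  | cov M => cov (M.restrict h)
  | newtonLeibniz M => newtonLeibniz (M.restrict h)

/-- Restriction does not change the values. [Kontsevich–Zagier 2001, §1.2] [cite: KontsevichZagier2001, §1.2] -/
@[simp] theorem gen_restrict (h : T' ⊆ T) (M : RawMoveFamilyOn T) : (M.restrict h).gen = M.gen := by
  cases M <;> rfl

/-- Restriction preserves tameness. [Kontsevich–Zagier 2001, §1.2] [cite: KontsevichZagier2001, §1.2] -/
theorem IsTame.restrict {N : ℕ} {M : RawMoveFamilyOn T} (hM : M.IsTame N) (h : T' ⊆ T) :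
    (M.restrict h).IsTame N := by
  cases M <;> exact hM

/-- Tameness is monotone in the bound. [Kontsevich–Zagier 2001, §1.2] [cite: KontsevichZagier2001, §1.2] -/
theorem IsTame.mono {N N' : ℕ} {M : RawMoveFamilyOn T} (hM : M.IsTame N) (hN : N ≤ N') :
    M.IsTame N' := by
  have hc : (N : ℝ) ≤ N' := Nat.cast_le.mpr hN
  cases M with
  | domainAdd M => exact ⟨hM.1.trans hN, hM.2.1.mono hN, hM.2.2.1.mono hN, hM.2.2.2.mono hN⟩
  | integrandAdd M => exact ⟨hM.1.trans hN, hM.2.1.mono hN, hM.2.2.1.mono hN, hM.2.2.2.mono hN⟩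
  | cov M => exact ⟨hM.1.trans hN, hM.2.1.mono hN, hM.2.2.mono hN⟩
  | newtonLeibniz M =>
    exact ⟨hM.1.trans hN, hM.2.1.mono hN, fun z hz => (hM.2.2.1 z hz).trans hc, hM.2.2.2.mono hN⟩

end RawMoveFamilyOn

/-- The type of **`N`-tame move families over `T`** (`RawMoveFamilyOn T` with `IsTame N`).
[Kontsevich–Zagier 2001, §1.2] [cite: KontsevichZagier2001, §1.2] -/
abbrev TameMoveFamily (N : ℕ) (T : Set ℝ) : Type := {M : RawMoveFamilyOn T // M.IsTame N}

/-- **Uniform chain over `T`.** A family `c : ℝ → RawGroup` of formal combinations of raw pairs is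
a *uniform chain over `T`* if there are finitely many move families `M₁, …, M_k` over `T` and
integer coefficients `s₁, …, s_k` with `c t = ∑ᵢ sᵢ • Mᵢ(t)` for ALL `t ∈ T`: one template of
moves, whose data vary `ℚ`-semialgebraically with the parameter, proves the identity `c t ∼ 0`
throughout `T`. [Kontsevich–Zagier 2001, §1.2] [cite: KontsevichZagier2001, §1.2] -/
def UniformChainOn (T : Set ℝ) (c : ℝ → RawGroup) : Prop :=
  ∃ (k : ℕ) (M : Fin k → RawMoveFamilyOn T) (s : Fin k → ℤ), ∀ t ∈ T, c t = ∑ i, s i • (M i).gen t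

/-- **Tame uniform chain over `T` of size `≤ N`.** As `UniformChainOn`, with at most `N` move
families, each `N`-tame, and signs `±1` as coefficients — the shape of an `N`-bounded certificate
of route InequalityCost (BoundedCost), uniformly in `t ∈ T`.
[Kontsevich–Zagier 2001, §1.2] [cite: KontsevichZagier2001, §1.2] -/
def TameUniformChainOn (N : ℕ) (T : Set ℝ) (c : ℝ → RawGroup) : Prop :=
  ∃ (k : ℕ) (M : Fin k → RawMoveFamilyOn T) (s : Fin k → ℤ), k ≤ N ∧ (∀ i, (M i).IsTame N) ∧
    (∀ i, s i = 1 ∨ s i = -1) ∧ ∀ t ∈ T, c t = ∑ i, s i • (M i).gen t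

/-- A uniform chain over `T` restricts to a uniform chain over any `T' ⊆ T`.
[Kontsevich–Zagier 2001, §1.2] [cite: KontsevichZagier2001, §1.2] -/
theorem UniformChainOn.mono {T T' : Set ℝ} {c : ℝ → RawGroup} (h : UniformChainOn T c)
    (hT : T' ⊆ T) : UniformChainOn T' c := by
  obtain ⟨k, M, s, hc⟩ := h
  refine ⟨k, fun i => (M i).restrict hT, s, fun t ht => ?_⟩
  simpa only [RawMoveFamilyOn.gen_restrict] using hc t (hT ht)

/-- A tame uniform chain is a uniform chain. [Kontsevich–Zagier 2001, §1.2] [cite: KontsevichZagier2001, §1.2] -/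
theorem TameUniformChainOn.uniformChainOn {N : ℕ} {T : Set ℝ} {c : ℝ → RawGroup}
    (h : TameUniformChainOn N T c) : UniformChainOn T c := by
  obtain ⟨k, M, s, -, -, -, hc⟩ := h
  exact ⟨k, M, s, hc⟩

/-- A tame uniform chain over `T` of size `≤ N` restricts to one over any `T' ⊆ T` and any larger
bound `N' ≥ N`. [Kontsevich–Zagier 2001, §1.2] [cite: KontsevichZagier2001, §1.2] -/
theorem TameUniformChainOn.mono {N N' : ℕ} {T T' : Set ℝ} {c : ℝ → RawGroup}
    (h : TameUniformChainOn N T c) (hT : T' ⊆ T) (hN : N ≤ N') : TameUniformChainOn N' T' c := by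
  obtain ⟨k, M, s, hk, hM, hs, hc⟩ := h
  refine ⟨k, fun i => (M i).restrict hT, s, hk.trans hN, fun i => ((hM i).restrict hT).mono hN, hs,
    fun t ht => ?_⟩
  simpa only [RawMoveFamilyOn.gen_restrict] using hc t (hT ht)

/-- The identically-zero family of formal combinations is a tame uniform chain of size `0` over
any parameter set (the empty template). [Kontsevich–Zagier 2001, §1.2] [cite: KontsevichZagier2001, §1.2] -/
theorem tameUniformChainOn_zero (N : ℕ) (T : Set ℝ) : TameUniformChainOn N T 0 :=
  ⟨0, Fin.elim0, Fin.elim0, Nat.zero_le N, fun i => i.elim0, fun i => i.elim0, fun t _ => by simp⟩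

/-- The identically-zero family is a uniform chain over any parameter set.
[Kontsevich–Zagier 2001, §1.2] [cite: KontsevichZagier2001, §1.2] -/
theorem uniformChainOn_zero (T : Set ℝ) : UniformChainOn T 0 :=
  (tameUniformChainOn_zero 0 T).uniformChainOn


/-! ### Rescaling the parameter of raw move families -/

section Rescale

variable {T : Set ℝ}

namespace RawFamily

/-- The total domain of a rescaled raw family (definitional). [van den Dries 1998, Ch. 3 (3.1)] [cite: Dries1998, Ch. 3 (3.1)] -/
@[simp] theorem rescale_total (q : ℚ) (S : RawFamily n) :
    (S.rescale q).total = {z | Fin.snoc (Fin.init z) ((q : ℝ) * z (Fin.last n)) ∈ S.total} :=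
  rfl

/-- The total integrand of a rescaled raw family (definitional). [van den Dries 1998, Ch. 3 (3.1)] [cite: Dries1998, Ch. 3 (3.1)] -/
@[simp] theorem rescale_integrand (q : ℚ) (S : RawFamily n) (z : Fin (n + 1) → ℝ) :
    (S.rescale q).integrand z = S.integrand (Fin.snoc (Fin.init z) ((q : ℝ) * z (Fin.last n))) :=
  rfl

end RawFamily

namespace RawDomainAddFamilyOn

/-- **Rescaling the parameter** of a domain-additivity family by a rational factor `q`: the family
`t ↦ M (q t)` over `{t | q t ∈ T}`. [van den Dries 1998, Ch. 3 (3.1)] [cite: Dries1998, Ch. 3 (3.1)] -/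
def rescale (q : ℚ) (M : RawDomainAddFamilyOn T n) : RawDomainAddFamilyOn {t | (q : ℝ) * t ∈ T} n where
  whole := M.whole.rescale q
  left := M.left.rescale q
  right := M.right.rescale q
  fibre_eq t ht := by simpa using M.fibre_eq ((q : ℝ) * t) ht
  volume_inter t ht := by simpa using M.volume_inter ((q : ℝ) * t) ht
  eqOn_left t ht := by simpa using M.eqOn_left ((q : ℝ) * t) ht
  eqOn_right t ht := by simpa using M.eqOn_right ((q : ℝ) * t) ht

/-- The values of the rescaled family. [van den Dries 1998, Ch. 3 (3.1)] [cite: Dries1998, Ch. 3 (3.1)] -/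
@[simp] theorem gen_rescale (q : ℚ) (M : RawDomainAddFamilyOn T n) (t : ℝ) :
    (M.rescale q).gen t = M.gen ((q : ℝ) * t) := by
  simp [gen, rescale]

end RawDomainAddFamilyOn

namespace RawIntegrandAddFamilyOn

/-- **Rescaling the parameter** of an integrand-additivity family by a rational factor `q`.
[van den Dries 1998, Ch. 3 (3.1)] [cite: Dries1998, Ch. 3 (3.1)] -/
def rescale (q : ℚ) (M : RawIntegrandAddFamilyOn T n) :
    RawIntegrandAddFamilyOn {t | (q : ℝ) * t ∈ T} n where
  whole := M.whole.rescale q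
  left := M.left.rescale q
  right := M.right.rescale q
  total_left := by rw [RawFamily.rescale_total, RawFamily.rescale_total, M.total_left]
  total_right := by rw [RawFamily.rescale_total, RawFamily.rescale_total, M.total_right]
  eqOn_add t ht := by simpa using M.eqOn_add ((q : ℝ) * t) ht

/-- The values of the rescaled family. [van den Dries 1998, Ch. 3 (3.1)] [cite: Dries1998, Ch. 3 (3.1)] -/
@[simp] theorem gen_rescale (q : ℚ) (M : RawIntegrandAddFamilyOn T n) (t : ℝ) :
    (M.rescale q).gen t = M.gen ((q : ℝ) * t) := by
  simp [gen, rescale]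

end RawIntegrandAddFamilyOn

namespace RawCovFamilyOn

/-- **Rescaling the parameter** of a change-of-variables family by a rational factor `q` (the total
change of variables is pulled back along `(x, t) ↦ (x, q t)`). [van den Dries 1998, Ch. 3 (3.1)] [cite: Dries1998, Ch. 3 (3.1)] -/
def rescale (q : ℚ) (M : RawCovFamilyOn T n) : RawCovFamilyOn {t | (q : ℝ) * t ∈ T} n where
  source := M.source.rescale q
  target := M.target.rescale q
  map z := M.map (Fin.snoc (Fin.init z) ((q : ℝ) * z (Fin.last n)))
  isSemialgebraicMapOn_map := by
    have h := M.isSemialgebraicMapOn_map.comp_aeval (rescalePoly n q)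
    simp only [aeval_rescalePoly, aeval_rescalePoly'] at h
    exact h
  injOn t ht := by simpa using M.injOn ((q : ℝ) * t) ht
  image_eq t ht := by simpa using M.image_eq ((q : ℝ) * t) ht
  hasFDerivWithinAt t ht x hx := by
    have hx' : x ∈ M.source.fibre ((q : ℝ) * t) := by simpa using hx
    simpa using M.hasFDerivWithinAt ((q : ℝ) * t) ht x hx'

/-- The fibre maps of the rescaled family. [van den Dries 1998, Ch. 3 (3.1)] [cite: Dries1998, Ch. 3 (3.1)] -/
@[simp] theorem fibreMap_rescale (q : ℚ) (M : RawCovFamilyOn T n) (t : ℝ) :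
    (M.rescale q).fibreMap t = M.fibreMap ((q : ℝ) * t) := by
  funext x
  simp [fibreMap, rescale]

/-- The values of the rescaled family. [van den Dries 1998, Ch. 3 (3.1)] [cite: Dries1998, Ch. 3 (3.1)] -/
@[simp] theorem gen_rescale (q : ℚ) (M : RawCovFamilyOn T n) (t : ℝ) :
    (M.rescale q).gen t = M.gen ((q : ℝ) * t) := by
  simp [gen, rescale]

end RawCovFamilyOn

namespace RawNLFamilyOn

/-- **Rescaling the parameter** of a Newton–Leibniz family by a rational factor `q` (band, base,
primitive and band bounds are pulled back along `(·, t) ↦ (·, q t)`).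
[van den Dries 1998, Ch. 3 (3.1)] [cite: Dries1998, Ch. 3 (3.1)] -/
def rescale (q : ℚ) (M : RawNLFamilyOn T n) : RawNLFamilyOn {t | (q : ℝ) * t ∈ T} n where
  band := M.band.rescale q
  base := M.base.rescale q
  prim z := M.prim (Fin.snoc (Fin.init z) ((q : ℝ) * z (Fin.last (n + 1))))
  lower z := M.lower (Fin.snoc (Fin.init z) ((q : ℝ) * z (Fin.last n)))
  upper z := M.upper (Fin.snoc (Fin.init z) ((q : ℝ) * z (Fin.last n)))
  isSemialgebraicFunOn_prim := by
    have h := M.isSemialgebraicFunOn_prim.comp_aeval (rescalePoly (n + 1) q)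
    simp only [aeval_rescalePoly, aeval_rescalePoly'] at h
    exact h
  isSemialgebraicFunOn_lower := by
    have h := M.isSemialgebraicFunOn_lower.comp_aeval (rescalePoly n q)
    simp only [aeval_rescalePoly, aeval_rescalePoly'] at h
    exact h
  isSemialgebraicFunOn_upper := by
    have h := M.isSemialgebraicFunOn_upper.comp_aeval (rescalePoly n q)
    simp only [aeval_rescalePoly, aeval_rescalePoly'] at h
    exact h
  lower_le_upper t ht x hx := by
    have hx' : x ∈ M.base.fibre ((q : ℝ) * t) := by simpa using hx
    simpa using M.lower_le_upper ((q : ℝ) * t) ht x hx'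
  fibre_band t ht := by simpa using M.fibre_band ((q : ℝ) * t) ht
  continuousOn t ht x hx := by
    have hx' : x ∈ M.base.fibre ((q : ℝ) * t) := by simpa using hx
    simpa using M.continuousOn ((q : ℝ) * t) ht x hx'
  hasDerivAt t ht x hx s hs := by
    have hx' : x ∈ M.base.fibre ((q : ℝ) * t) := by simpa using hx
    have hs' : s ∈ Ioo (M.lower (Fin.snoc x ((q : ℝ) * t))) (M.upper (Fin.snoc x ((q : ℝ) * t))) := by
      simpa using hs
    simpa using M.hasDerivAt ((q : ℝ) * t) ht x hx' s hs'
  base_eq t ht x hx := by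
    have hx' : x ∈ M.base.fibre ((q : ℝ) * t) := by simpa using hx
    simpa using M.base_eq ((q : ℝ) * t) ht x hx'

/-- The values of the rescaled family. [van den Dries 1998, Ch. 3 (3.1)] [cite: Dries1998, Ch. 3 (3.1)] -/
@[simp] theorem gen_rescale (q : ℚ) (M : RawNLFamilyOn T n) (t : ℝ) :
    (M.rescale q).gen t = M.gen ((q : ℝ) * t) := by
  simp [gen, rescale]

end RawNLFamilyOn

namespace RawMoveFamilyOn

/-- **Rescaling the parameter of a raw move family** by a rational factor `q`: the family
`t ↦ M (q t)` over `{t | q t ∈ T}` (e.g. `q = δ ∈ ℚ` moves a family over `Set.Ioo 0 δ` to one over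
`Set.Ioo 0 1`). [van den Dries 1998, Ch. 3 (3.1)] [cite: Dries1998, Ch. 3 (3.1)] -/
def rescale (q : ℚ) : RawMoveFamilyOn T → RawMoveFamilyOn {t | (q : ℝ) * t ∈ T}
  | domainAdd M => domainAdd (M.rescale q)
  | integrandAdd M => integrandAdd (M.rescale q)
  | cov M => cov (M.rescale q)
  | newtonLeibniz M => newtonLeibniz (M.rescale q)

/-- The values of the rescaled raw move family: `(M.rescale q) t = M (q t)`.
[van den Dries 1998, Ch. 3 (3.1)] [cite: Dries1998, Ch. 3 (3.1)] -/
@[simp] theorem gen_rescale (q : ℚ) (M : RawMoveFamilyOn T) (t : ℝ) :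
    (M.rescale q).gen t = M.gen ((q : ℝ) * t) := by
  cases M <;> simp [gen, rescale]

end RawMoveFamilyOn

/-- **Rescaling a uniform chain**: if `c` is a uniform chain over `T` then `t ↦ c (q t)` is a uniform
chain over `{t | q t ∈ T}`, for every rational factor `q`. [Kontsevich–Zagier 2001, §1.2] [cite: KontsevichZagier2001, §1.2] -/
theorem UniformChainOn.rescale {c : ℝ → RawGroup} (h : UniformChainOn T c) (q : ℚ) :
    UniformChainOn {t | (q : ℝ) * t ∈ T} (fun t => c ((q : ℝ) * t)) := by
  obtain ⟨k, M, s, hc⟩ := h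
  refine ⟨k, fun i => (M i).rescale q, s, fun t ht => ?_⟩
  simpa only [RawMoveFamilyOn.gen_rescale] using hc ((q : ℝ) * t) ht

/-- The parameter set `{t | δ t ∈ Set.Ioo 0 δ}` is `Set.Ioo 0 1` for `δ > 0`: rescaling by `δ`
moves families over `(0, δ)` to families over `(0, 1)`. [folklore] -/
theorem setOf_mul_mem_Ioo {δ : ℝ} (hδ : 0 < δ) : {t : ℝ | δ * t ∈ Ioo 0 δ} = Ioo 0 1 := by
  ext t
  simp only [mem_setOf_eq, mem_Ioo]
  constructor
  · rintro ⟨h1, h2⟩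
    exact ⟨(mul_pos_iff_of_pos_left hδ).mp h1, by nlinarith⟩
  · rintro ⟨h1, h2⟩
    exact ⟨mul_pos hδ h1, by nlinarith⟩

end Rescale

end KZ

end Literature.NumberTheory.Transcendental
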